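import Literature.Geometry.Symplectic.OrigamiCutSpace
import Literature.Geometry.Symplectic.OrigamiCutFormKernel
import HarnessLib

/-!
# The reduced symplectic form on the cut space `N ×_{S¹} ℂ`

Proofs companion of `OrigamiUnfolding.lean` (the named fact
`Literature.Geometry.Symplectic.exists_symplecticCutPieces_of_isOrigamiForm`, Cannas da
Silva–Guillemin–Pires, *Symplectic Origami*, IMRN 2011 = arXiv:0909.4065, Prop. 2.8), step (S2)
concluded: the cut form `Ω = p^*ωZ + d(|w|² p^*α) - 2 dx∧dy` (`cutForm`, basic for the diagonal
action by `OrigamiCutFormBasic.lean`) descends to the cut space `CutSpace k N = ProdC k N / S¹`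
(`OrigamiCutSpace.lean`); the descended form is the tree's rendering of the reduced symplectic
form on `μ⁻¹(0)/S¹` (proof of Prop. 2.8), with the centre `B = N/S¹` symplectically embedded by
the zero section ("with a natural embedding of `(B, ω_B)` as a symplectic submanifold").

* `IsCircleBasicForm.circleDescend_nondegenerate_at` — the pointwise form of
  `circleDescend_nondegenerate` (general free circle actions);
* `cutFormQ hθ hfree ωZ α` — the descended form; `cutFormQ_apply_cutMk` (its values on
  `dπ`-images: the value formula of `cutForm`), `isSmoothForm_cutFormQ`, `isClosedForm_cutFormQ`;
* **`cutFormQ_nondegenerate_at`** — non-degeneracy at `[n, w]` from the non-degeneracy of the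
  auxiliary form `Θ̂_{|w|²}` at `n` (`OrigamiCutFormKernel.lean`: the kernel of `Ω` is the orbit
  line);
* **`cutFormQ_cutZero_nondegenerate`** — the zero section is a symplectic submanifold: on
  `d(cutZero)`-images the form is `ω_B`, non-degenerate because `ker ωZ_n = ℝ X_n`.

Everything here is proved; the only definition is `cutFormQ`; no facts.

## References

* A. Cannas da Silva, V. Guillemin, A. R. Pires, *Symplectic Origami*, IMRN 2011 =
  arXiv:0909.4065, §2.3, proof of Prop. 2.8. [CannasdasilvaGuilleminPires2010]
-/

noncomputable section

open scoped Manifold ContDiff Topology RealInnerProductSpace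
open Set Function Filter TopologicalSpace
open Literature.Geometry.Kaehler Literature.Geometry.Manifold

namespace Literature.Geometry.Symplectic

/-! ### Pointwise descent of non-degeneracy (general free circle actions) -/

section General

variable {m : ℕ} {N : Type*} [TopologicalSpace N] [ChartedSpace (EuclideanSpace ℝ (Fin m)) N]
  [IsManifold (𝓡 m) ∞ N] [T2Space N] [MulAction Circle N]
  {F : Type*} [NormedAddCommGroup F] [NormedSpace ℝ F] [FiniteDimensional ℝ F]
  (hθ : ContMDiff ((𝓡 1).prod (𝓡 m)) (𝓡 m) ∞ (fun x : Circle × N => x.1 • x.2))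
  (hfree : ∀ (a : Circle) (x : N), a • x = x → a = 1)
  (hF : Module.finrank ℝ F + 1 = m)

include hθ hfree hF in
/-- **Non-degeneracy descends, pointwise**: if at `n` every `α`-null vector is killed by `dπ_n`,
the descended `2`-form is non-degenerate at `π n`. [cite: CannasdasilvaGuilleminPires2010, Def. 2.2] -/
theorem IsCircleBasicForm.circleDescend_nondegenerate_at {α : MForm (𝓡 m) N ℝ 2}
    (hα : IsCircleBasicForm α) (n : N)
    (hker : letI := circleQuotientChartedSpace F hθ hfree hF
      ∀ v : TangentSpace (𝓡 m) n, (∀ w, α n ![v, w] = 0) →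
        mfderiv (𝓡 m) 𝓘(ℝ, F) (circleQuotientMk : N → CircleQuotient N) n v = 0) :
    letI := circleQuotientChartedSpace F hθ hfree hF
    ∀ u : TangentSpace 𝓘(ℝ, F) (circleQuotientMk n : CircleQuotient N), u ≠ 0 →
      ∃ u' : TangentSpace 𝓘(ℝ, F) (circleQuotientMk n : CircleQuotient N),
        circleDescend hθ hfree hF α (circleQuotientMk n) ![u, u'] ≠ 0 := by
  letI := circleQuotientChartedSpace F hθ hfree hF
  intro u hu
  obtain ⟨v, rfl⟩ := surjective_mfderiv_circleQuotientMk hθ hfree hF n u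
  by_contra hcon
  push Not at hcon
  apply hu
  apply hker v
  intro w
  have h := hcon (mfderiv (𝓡 m) 𝓘(ℝ, F) (circleQuotientMk : N → CircleQuotient N) n w)
  have hvec : (![mfderiv (𝓡 m) 𝓘(ℝ, F) (circleQuotientMk : N → CircleQuotient N) n v,
      mfderiv (𝓡 m) 𝓘(ℝ, F) (circleQuotientMk : N → CircleQuotient N) n w] :
        Fin 2 → TangentSpace 𝓘(ℝ, F) (circleQuotientMk n : CircleQuotient N)) =
      fun i => mfderiv (𝓡 m) 𝓘(ℝ, F) (circleQuotientMk : N → CircleQuotient N) n (![v, w] i) := by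
    funext i
    fin_cases i <;> rfl
  rw [hvec, hα.circleDescend_apply hθ hfree hF n ![v, w]] at h
  exact h

include hθ hfree hF in
/-- Values of the descended form on a pair of `dπ`-images. [folklore] -/
theorem IsCircleBasicForm.circleDescend_apply_two {α : MForm (𝓡 m) N ℝ 2}
    (hα : IsCircleBasicForm α) (n : N) (v w : TangentSpace (𝓡 m) n) :
    letI := circleQuotientChartedSpace F hθ hfree hF
    circleDescend hθ hfree hF α (circleQuotientMk n)
      ![mfderiv (𝓡 m) 𝓘(ℝ, F) (circleQuotientMk : N → CircleQuotient N) n v,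
        mfderiv (𝓡 m) 𝓘(ℝ, F) (circleQuotientMk : N → CircleQuotient N) n w] = α n ![v, w] := by
  letI := circleQuotientChartedSpace F hθ hfree hF
  have hvec : (![mfderiv (𝓡 m) 𝓘(ℝ, F) (circleQuotientMk : N → CircleQuotient N) n v,
      mfderiv (𝓡 m) 𝓘(ℝ, F) (circleQuotientMk : N → CircleQuotient N) n w] :
        Fin 2 → TangentSpace 𝓘(ℝ, F) (circleQuotientMk n : CircleQuotient N)) =
      fun i => mfderiv (𝓡 m) 𝓘(ℝ, F) (circleQuotientMk : N → CircleQuotient N) n (![v, w] i) := by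
    funext i
    fin_cases i <;> rfl
  rw [hvec]
  exact hα.circleDescend_apply hθ hfree hF n ![v, w]

end General

/-! ### The descended cut form -/

variable {k : ℕ} {N : Type*} [TopologicalSpace N] [ChartedSpace (EuclideanSpace ℝ (Fin k)) N]
  [IsManifold (𝓡 k) ∞ N] [T2Space N] [MulAction Circle N]
  (hθ : ContMDiff ((𝓡 1).prod (𝓡 k)) (𝓡 k) ∞ (fun x : Circle × N => x.1 • x.2))
  (hfree : ∀ (a : Circle) (x : N), a • x = x → a = 1)

/-- **The reduced form on the cut space** `CutSpace k N = N ×_{S¹} ℂ`: the descent of the cut form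
`cutForm ωZ α`. [cite: CannasdasilvaGuilleminPires2010, Prop. 2.8] -/
def cutFormQ (ωZ : MForm (𝓡 k) N ℝ 2) (α : MForm (𝓡 k) N ℝ 1) :
    letI := cutChartedSpace hθ hfree
    MForm (𝓡 (k + 1)) (CutSpace k N) ℝ 2 :=
  circleDescend (ProdC.contMDiff_smul_prodC hθ) (ProdC.smul_eq_self_prodC hfree)
    (show Module.finrank ℝ (EuclideanSpace ℝ (Fin (k + 1))) + 1 = k + 2 by rw [finrank_euclideanSpace_fin]) (cutForm ωZ α)

section Hyp

variable {ωZ : MForm (𝓡 k) N ℝ 2} {α : MForm (𝓡 k) N ℝ 1}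
  (hωZb : IsCircleBasicForm ωZ) (hωZs : IsSmoothForm ωZ) (hα : IsSmoothForm α)
  (hαi : ∀ (a : Circle) (n : N) (v : Fin 1 → TangentSpace (𝓡 k) n),
    α (a • n) (fun i => mfderiv (𝓡 k) (𝓡 k) (fun y : N => a • y) n (v i)) = α n v)
  (hαX : ∀ n : N, α n ![circleFundVec n] = 1)
  (hdα : IsCircleBasicForm (mextDeriv α))

include hωZb hα hαi hαX hdα in
/-- **`π^* Ω_Q = Ω`**: the pull-back of the reduced form along the orbit map is the cut form.
[cite: CannasdasilvaGuilleminPires2010, Prop. 2.8] -/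
theorem pullback_cutFormQ :
    letI := cutChartedSpace hθ hfree
    (cutFormQ hθ hfree ωZ α).pullback (𝓡 (k + 2)) (circleQuotientMk : ProdC k N → CutSpace k N) =
      cutForm ωZ α := by
  letI := cutChartedSpace hθ hfree
  exact (isCircleBasicForm_cutForm hθ hωZb hα hαi hαX hdα).pullback_circleDescend _ _ _

include hωZb hα hαi hαX hdα in
/-- **Values of the reduced form** at `[n, w]` on the `dπ`-images of the frame vectors
`L (a, σ)`, `L (b, τ)`. [cite: CannasdasilvaGuilleminPires2010, Prop. 2.8] -/
theorem cutFormQ_apply_cutMk (n : N) (w : ℂ) (a b : TangentSpace (𝓡 k) n) (σ τ : ℂ) :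
    letI := cutChartedSpace hθ hfree
    cutFormQ hθ hfree ωZ α (cutMk n w)
      ![mfderiv (𝓡 (k + 2)) (𝓡 (k + 1)) (circleQuotientMk : ProdC k N → CutSpace k N)
          (ProdC.mk n w) (ProdC.tangentLift k a σ),
        mfderiv (𝓡 (k + 2)) (𝓡 (k + 1)) (circleQuotientMk : ProdC k N → CutSpace k N)
          (ProdC.mk n w) (ProdC.tangentLift k b τ)] =
      ωZ n ![a, b] + ‖w‖ ^ 2 * mextDeriv α n ![a, b] +
        (2 * ⟪w, σ⟫ * α n ![b] - 2 * ⟪w, τ⟫ * α n ![a]) - 2 * (σ.re * τ.im - σ.im * τ.re) := by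
  letI := cutChartedSpace hθ hfree
  have h := (isCircleBasicForm_cutForm hθ hωZb hα hαi hαX hdα).circleDescend_apply_two
    (ProdC.contMDiff_smul_prodC hθ) (ProdC.smul_eq_self_prodC hfree)
    (show Module.finrank ℝ (EuclideanSpace ℝ (Fin (k + 1))) + 1 = k + 2 by rw [finrank_euclideanSpace_fin]) (ProdC.mk n w : ProdC k N)
    (ProdC.tangentLift k a σ) (ProdC.tangentLift k b τ)
  refine h.trans ?_
  have h2 := cutForm_apply_tangentLift_eq ωZ hα (ProdC.mk n w : ProdC k N) a b σ τ
  rw [ProdC.fst_mk, ProdC.snd_mk] at h2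
  exact h2

include hωZb hωZs hα hαi hαX hdα in
/-- **The reduced form is smooth.** [cite: CannasdasilvaGuilleminPires2010, Prop. 2.8] -/
theorem isSmoothForm_cutFormQ :
    letI := cutChartedSpace hθ hfree
    IsSmoothForm (cutFormQ hθ hfree ωZ α) := by
  letI := cutChartedSpace hθ hfree
  exact (isCircleBasicForm_cutForm hθ hωZb hα hαi hαX hdα).isSmoothForm_circleDescend _ _ _
    (isSmoothForm_cutForm hωZs hα)

include hωZb hωZs hα hαi hαX hdα in
/-- **The reduced form is closed** (for closed `ωZ`). [cite: CannasdasilvaGuilleminPires2010, Prop. 2.8] -/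
theorem isClosedForm_cutFormQ (hωZc : IsClosedForm ωZ) :
    letI := cutChartedSpace hθ hfree
    IsClosedForm (cutFormQ hθ hfree ωZ α) := by
  letI := cutChartedSpace hθ hfree
  exact (isCircleBasicForm_cutForm hθ hωZb hα hαi hαX hdα).isClosedForm_circleDescend _ _ _
    (isSmoothForm_cutForm hωZs hα) (isClosedForm_cutForm hωZs hωZc hα)

include hωZb hα hαi hαX hdα in
/-- **The reduced form is non-degenerate at `[n, w]`** as soon as the auxiliary form `Θ̂_{|w|²}`
is non-degenerate at `n` (kernel of `Ω` = orbit line, `OrigamiCutFormKernel.lean`).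
[cite: CannasdasilvaGuilleminPires2010, Prop. 2.8] -/
theorem cutFormQ_nondegenerate_at (n : N) (w : ℂ)
    (haux : ∀ (a : TangentSpace (𝓡 k) n) (σ : ℝ),
      (∀ (b : TangentSpace (𝓡 k) n) (τ : ℝ),
        ωZ n ![a, b] + ‖w‖ ^ 2 * mextDeriv α n ![a, b] + (σ * α n ![b] - τ * α n ![a]) = 0) →
        a = 0 ∧ σ = 0) :
    letI := cutChartedSpace hθ hfree
    ∀ u : TangentSpace (𝓡 (k + 1)) (cutMk n w : CutSpace k N), u ≠ 0 →
      ∃ u' : TangentSpace (𝓡 (k + 1)) (cutMk n w : CutSpace k N),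
        cutFormQ hθ hfree ωZ α (cutMk n w) ![u, u'] ≠ 0 := by
  letI := cutChartedSpace hθ hfree
  refine (isCircleBasicForm_cutForm hθ hωZb hα hαi hαX hdα).circleDescend_nondegenerate_at
    (ProdC.contMDiff_smul_prodC hθ) (ProdC.smul_eq_self_prodC hfree)
    (show Module.finrank ℝ (EuclideanSpace ℝ (Fin (k + 1))) + 1 = k + 2 by rw [finrank_euclideanSpace_fin]) (ProdC.mk n w : ProdC k N) ?_
  intro v hv
  exact cutForm_null_imp_mfderiv_circleQuotientMk_eq_zero hθ hfree ωZ hα (ProdC.mk n w : ProdC k N)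
    (fun b => hωZb.horizontal n ![circleFundVec n, b] 0 rfl)
    (fun b => hdα.horizontal n ![circleFundVec n, b] 0 rfl) (hαX n) haux v hv

/-! ### The zero section is symplectic -/

include hα in
omit [T2Space N] [MulAction Circle N] in
/-- On the zero section the cut form restricts to `ωZ`: `Ω_{(n,0)}(L(a,0), L(b,0)) = ωZ_n(a,b)`.
[cite: CannasdasilvaGuilleminPires2010, Prop. 2.8] -/
theorem cutForm_apply_zero_section (n : N) (a b : TangentSpace (𝓡 k) n) :
    cutForm ωZ α (ProdC.mk n 0 : ProdC k N) ![ProdC.tangentLift k a 0, ProdC.tangentLift k b 0] =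
      ωZ n ![a, b] := by
  have h := cutForm_apply_tangentLift_eq ωZ hα (ProdC.mk n 0 : ProdC k N) a b 0 0
  rw [ProdC.fst_mk, ProdC.snd_mk] at h
  rw [h]
  simp

/-- The differential of `n ↦ [n, 0]`: `d(cutMk · 0)_n v = dπ (L (v, 0))`. [folklore] -/
theorem mfderiv_cutMk_zero_apply (n : N) (v : TangentSpace (𝓡 k) n) :
    letI := cutChartedSpace hθ hfree
    mfderiv (𝓡 k) (𝓡 (k + 1)) (fun n : N => (cutMk n 0 : CutSpace k N)) n v =
      mfderiv (𝓡 (k + 2)) (𝓡 (k + 1)) (circleQuotientMk : ProdC k N → CutSpace k N)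
        (ProdC.mk n 0) (ProdC.tangentLift k v 0) := by
  letI := cutChartedSpace hθ hfree
  haveI := isManifold_cutSpace hθ hfree
  have hsec : ContMDiff (𝓡 k) (𝓡 (k + 2)) ∞ (fun n : N => (ProdC.mk n 0 : ProdC k N)) :=
    ContMDiff.prodC_mk contMDiff_id contMDiff_const
  have h := mfderiv_comp n
    (((contMDiff_circleQuotientMk_prodC hθ hfree) (ProdC.mk n 0)).mdifferentiableAt (by simp))
    ((hsec n).mdifferentiableAt (by simp))
  have H : HasMFDerivAt (𝓡 k) (𝓡 (k + 2)) (fun n : N => (ProdC.mk n 0 : ProdC k N)) n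
      ((prodCModelIso k : (EuclideanSpace ℝ (Fin k) × ℂ) →L[ℝ]
        EuclideanSpace ℝ (Fin (k + 2))).comp
        ((ContinuousLinearMap.id ℝ (TangentSpace (𝓡 k) n)).prod 0)) :=
    ProdC.hasMFDerivAt_prodC_mk (N := N) (x := n) (hasMFDerivAt_id (I := 𝓡 k) n)
      (hasMFDerivAt_const (I := 𝓡 k) (I' := 𝓘(ℝ, ℂ)) (0 : ℂ) n)
  have hsecd : mfderiv (𝓡 k) (𝓡 (k + 2)) (fun n : N => (ProdC.mk n 0 : ProdC k N)) n v =
      ProdC.tangentLift k v 0 := by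
    rw [H.mfderiv]
    rfl
  rw [← hsecd]
  exact congrArg (fun L => L v) h

include hωZb hα hαi hαX hdα in
/-- **The zero section is a symplectic submanifold for the reduced form**: for every non-zero
tangent vector `u` of `N/S¹` at `y` there is `u'` with
`Ω_Q (cutZero y) (d cutZero u, d cutZero u') ≠ 0` — on such images the form is `ωZ`
(`cutForm_apply_zero_section`), and `ωZ_n(v, ·) = 0` only for `v ∈ ℝ X_n = ker dπ_n`.
[cite: CannasdasilvaGuilleminPires2010, Prop. 2.8] -/
theorem cutFormQ_cutZero_nondegenerate {F : Type*} [NormedAddCommGroup F] [NormedSpace ℝ F]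
    [FiniteDimensional ℝ F] (hF : Module.finrank ℝ F + 1 = k)
    (hker : ∀ (n : N) (a : TangentSpace (𝓡 k) n), (∀ b, ωZ n ![a, b] = 0) →
      ∃ c : ℝ, a = c • circleFundVec n) :
    letI := cutChartedSpace hθ hfree
    letI := circleQuotientChartedSpace F hθ hfree hF
    ∀ (y : CircleQuotient N) (u : TangentSpace 𝓘(ℝ, F) y), u ≠ 0 →
      ∃ u' : TangentSpace 𝓘(ℝ, F) y,
        cutFormQ hθ hfree ωZ α (cutZero y)
          ![mfderiv 𝓘(ℝ, F) (𝓡 (k + 1)) (cutZero : CircleQuotient N → CutSpace k N) y u,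
            mfderiv 𝓘(ℝ, F) (𝓡 (k + 1)) (cutZero : CircleQuotient N → CutSpace k N) y u'] ≠ 0 := by
  letI := cutChartedSpace hθ hfree
  haveI := isManifold_cutSpace hθ hfree
  letI := circleQuotientChartedSpace F hθ hfree hF
  haveI := isManifold_circleQuotient (F := F) hθ hfree hF
  intro y u hu
  obtain ⟨n, rfl⟩ := circleQuotientMk_surjective y
  obtain ⟨v, rfl⟩ := surjective_mfderiv_circleQuotientMk hθ hfree hF n u
  -- `d cutZero (dπ_N v') = dπ (L (v', 0))`
  have hs : ContMDiff (𝓡 k) (𝓡 (k + 1)) ∞ (fun n : N => (cutMk n 0 : CutSpace k N)) :=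
    (contMDiff_cutMkUncurry hθ hfree).comp (contMDiff_id.prodMk contMDiff_const)
  have hchain : ∀ v' : TangentSpace (𝓡 k) n,
      mfderiv 𝓘(ℝ, F) (𝓡 (k + 1)) (cutZero : CircleQuotient N → CutSpace k N) (circleQuotientMk n)
        (mfderiv (𝓡 k) 𝓘(ℝ, F) (circleQuotientMk : N → CircleQuotient N) n v') =
      mfderiv (𝓡 (k + 2)) (𝓡 (k + 1)) (circleQuotientMk : ProdC k N → CutSpace k N)
        (ProdC.mk n 0) (ProdC.tangentLift k v' 0) := by
    intro v'
    rw [show (cutZero : CircleQuotient N → CutSpace k N) =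
        circleQuotientLift (fun n : N => (cutMk n 0 : CutSpace k N)) cutMk_zero_smul from rfl,
      mfderiv_circleQuotientLift_apply hθ hfree hF cutMk_zero_smul hs.contMDiffAt v']
    exact mfderiv_cutMk_zero_apply hθ hfree n v'
  -- a partner `b` with `ωZ(v, b) ≠ 0`
  have hvX : ¬ ∀ b, ωZ n ![v, b] = 0 := by
    intro hnull
    obtain ⟨c, rfl⟩ := hker n v hnull
    apply hu
    rw [map_smul, circleFundVec_eq, mfderiv_circleQuotientMk_apply_orbit hθ hfree hF n, smul_zero]
  push Not at hvX
  obtain ⟨b, hb⟩ := hvX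
  refine ⟨mfderiv (𝓡 k) 𝓘(ℝ, F) (circleQuotientMk : N → CircleQuotient N) n b, ?_⟩
  rw [hchain v, hchain b, show cutZero (circleQuotientMk n) = (cutMk n 0 : CutSpace k N) from rfl,
    cutFormQ_apply_cutMk hθ hfree hωZb hα hαi hαX hdα n 0 v b 0 0]
  simpa using hb

end Hyp

end Literature.Geometry.Symplectic

end
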